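import Summits.KontsevichZagierPeriods.Zeta5Search.Certificates.PolyReflectShadow
import HarnessLib

/-!
# Kronecker-packed module reduction: the kernel eliminates on big integers (cell `pub-zeta5`, certifier `cert-2`)

HONEST FRAMING: systematic search; no irrationality claim unless certified.

OUR infrastructure (Summit side). The fraction-free elimination `elimRun` of `Certificates/PolyReflectElim` is sound but the
kernel is far too slow at multiplying dense trivariate polynomials coefficient by coefficient (measured: > 30 min for the
brown9 R-NK reduction). Here the SAME elimination is run on KRONECKER-PACKED integers: every `Poly3` datum `p` is replaced
by the integer `p(β, β^{D₁}, β^{D₁D₂})` (`evZ3`, Horner), every polynomial operation by ONE big-integer operation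
(`elimRunZ`; the kernel's GMP arithmetic does the R-NK reduction in well under a minute). Soundness
(`lcEval_eq_zero_of_packedRun`): evaluation is a ring homomorphism, so the packed run computes the packed value of the
symbolic result; the symbolic result — never computed — has row lengths `≤ D₁`, block lengths `≤ D₂` and 1-norm `< β` by
the SHADOW bounds of `Certificates/PolyReflectShadow` (`elimShadow`, checked by `decide`); and an integer polynomial with
those bounds whose packed value vanishes is the zero polynomial (`ev3_eq_zero_of_evZ3_eq_zero`, positional uniqueness).
No mathematics specific to ζ(5) lives here.
-/

namespace Summit.KontsevichZagierPeriods.Zeta5Search.PolyReflect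

/-! ### Integer Horner evaluation and its relation to `ev1/ev2/ev3` -/

/-- Integer Horner evaluation of a coefficient list. -/
def evZ1 : List ℤ → ℤ → ℤ
  | [], _ => 0
  | a :: p, w => a + w * evZ1 p w

/-- Integer evaluation of a `Poly2`. -/
def evZ2 : Poly2 → ℤ → ℤ → ℤ
  | [], _, _ => 0
  | a :: p, w, x => evZ1 a w + x * evZ2 p w x

/-- Integer evaluation of a `Poly3`. -/
def evZ3 : Poly3 → ℤ → ℤ → ℤ → ℤ
  | [], _, _, _ => 0
  | a :: p, w, x, k => evZ2 a w x + k * evZ3 p w x k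

/-- `evZ1` is `ev1` at integer points. -/
theorem cast_evZ1 : ∀ (p : List ℤ) (w : ℤ), ((evZ1 p w : ℤ) : ℚ) = ev1 p w
  | [], w => by simp [evZ1]
  | a :: p, w => by simp [evZ1, cast_evZ1 p w]

/-- `evZ2` is `ev2` at integer points. -/
theorem cast_evZ2 : ∀ (p : Poly2) (w x : ℤ), ((evZ2 p w x : ℤ) : ℚ) = ev2 p w x
  | [], w, x => by simp [evZ2]
  | a :: p, w, x => by simp [evZ2, cast_evZ2 p w x, cast_evZ1]

/-- `evZ3` is `ev3` at integer points. -/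
theorem cast_evZ3 : ∀ (p : Poly3) (w x k : ℤ), ((evZ3 p w x k : ℤ) : ℚ) = ev3 p w x k
  | [], w, x, k => by simp [evZ3]
  | a :: p, w, x, k => by simp [evZ3, cast_evZ3 p w x k, cast_evZ2]

/-- `evZ3` is additive. -/
theorem evZ3_add3 (p q : Poly3) (w x k : ℤ) : evZ3 (add3 p q) w x k = evZ3 p w x k + evZ3 q w x k := by
  have h := ev3_add3 p q w x k
  rw [← cast_evZ3, ← cast_evZ3, ← cast_evZ3] at h
  exact_mod_cast h

/-- `evZ3` is multiplicative. -/
theorem evZ3_mul3 (p q : Poly3) (w x k : ℤ) : evZ3 (mul3 p q) w x k = evZ3 p w x k * evZ3 q w x k := by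
  have h := ev3_mul3 p q w x k
  rw [← cast_evZ3, ← cast_evZ3, ← cast_evZ3] at h
  exact_mod_cast h

/-- `evZ3` of a negation. -/
theorem evZ3_neg3 (p : Poly3) (w x k : ℤ) : evZ3 (neg3 p) w x k = -evZ3 p w x k := by
  have h := ev3_neg3 p w x k
  rw [← cast_evZ3, ← cast_evZ3] at h
  exact_mod_cast h

/-! ### Positional uniqueness: small digits and a vanishing Horner value force vanishing digits -/

/-- Size of a Horner value: digits of absolute value summing to `S`, at most `n+1` of them, base `B ≥ 1`. -/
theorem natAbs_evZ1_le (B : ℤ) (hB : 1 ≤ B) :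
    ∀ (ds : List ℤ) (n : ℕ), ds.length ≤ n + 1 → (evZ1 ds B).natAbs ≤ norm1 ds * B.natAbs ^ n
  | [], n, _ => by simp [evZ1]
  | d :: ds, n, hlen => by
    rw [evZ1, norm1_cons]
    have hB' : 1 ≤ B.natAbs := by
      have := Int.natAbs_of_nonneg (show 0 ≤ B by linarith); omega
    rcases ds with _ | ⟨d', ds'⟩
    · simp [evZ1]
      exact le_mul_of_one_le_right (Nat.zero_le _) (Nat.one_le_pow _ _ hB')
    · obtain ⟨m, rfl⟩ : ∃ m, n = m + 1 := ⟨n - 1, by simp at hlen; omega⟩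
      have ih := natAbs_evZ1_le B hB (d' :: ds') m (by simp at hlen ⊢; omega)
      calc (d + B * evZ1 (d' :: ds') B).natAbs
          ≤ d.natAbs + (B * evZ1 (d' :: ds') B).natAbs := Int.natAbs_add_le _ _
        _ = d.natAbs + B.natAbs * (evZ1 (d' :: ds') B).natAbs := by rw [Int.natAbs_mul]
        _ ≤ d.natAbs * B.natAbs ^ (m + 1) + B.natAbs * (norm1 (d' :: ds') * B.natAbs ^ m) := by
            have := Nat.mul_le_mul_left B.natAbs ih
            have h2 : d.natAbs ≤ d.natAbs * B.natAbs ^ (m + 1) :=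
              le_mul_of_one_le_right (Nat.zero_le _) (Nat.one_le_pow _ _ hB')
            omega
        _ = (d.natAbs + norm1 (d' :: ds')) * B.natAbs ^ (m + 1) := by ring

/-- **Digit uniqueness**: digits of absolute value `< B` with Horner value `0` are all `0`. -/
theorem digits_eq_zero (B : ℤ) (hB : 1 ≤ B) :
    ∀ ds : List ℤ, (∀ d ∈ ds, d.natAbs < B.natAbs) → evZ1 ds B = 0 → ∀ d ∈ ds, d = 0
  | [], _, _ => by simp
  | d :: ds, hd, h0 => by
    rw [evZ1] at h0
    have hdB : d.natAbs < B.natAbs := hd d (by simp)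
    -- `d = -B * e` with `|d| < |B|` forces `e = 0`
    have hdvd : B ∣ d := ⟨-evZ1 ds B, by linarith⟩
    have hd0 : d = 0 := by
      rcases hdvd with ⟨e, he⟩
      rcases eq_or_ne e 0 with he0 | he0
      · simp [he, he0]
      · exfalso
        rw [he, Int.natAbs_mul] at hdB
        have : 1 ≤ e.natAbs := Int.natAbs_pos.2 he0
        have := Nat.mul_le_mul_left B.natAbs this
        omega
    have hrest : evZ1 ds B = 0 := by
      have hB0 : B ≠ 0 := by linarith
      have : B * evZ1 ds B = 0 := by rw [hd0] at h0; simpa using h0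
      exact (mul_eq_zero.1 this).resolve_left hB0
    intro d₁ hd₁
    rcases List.mem_cons.1 hd₁ with rfl | hd₁
    · exact hd0
    · exact digits_eq_zero B hB ds (fun e he => hd e (by simp [he])) hrest d₁ hd₁

/-- `evZ2` as a Horner value of the row values. -/
theorem evZ2_eq_evZ1_map : ∀ (p : Poly2) (w x : ℤ), evZ2 p w x = evZ1 (p.map fun r => evZ1 r w) x
  | [], w, x => by simp [evZ2, evZ1]
  | a :: p, w, x => by simp [evZ2, evZ1, evZ2_eq_evZ1_map p w x]

/-- `evZ3` as a Horner value of the block values. -/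
theorem evZ3_eq_evZ1_map : ∀ (p : Poly3) (w x k : ℤ), evZ3 p w x k = evZ1 (p.map fun b => evZ2 b w x) k
  | [], w, x, k => by simp [evZ3, evZ1]
  | a :: p, w, x, k => by simp [evZ3, evZ1, evZ3_eq_evZ1_map p w x k]

/-- `norm1` of a mapped list is the sum of the absolute values. -/
theorem norm1_map_le {α : Type*} (l : List α) (f : α → ℤ) (g : α → ℕ) (h : ∀ a ∈ l, (f a).natAbs ≤ g a) :
    norm1 (l.map f) ≤ (l.map g).sum := by
  induction l with
  | nil => simp
  | cons a l ih =>
    simp only [List.map_cons, norm1_cons, List.sum_cons]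
    exact Nat.add_le_add (h a (by simp)) (ih fun b hb => h b (by simp [hb]))

/-- Sum of `norm1` over the rows is `norm2`. -/
theorem sum_map_norm1 : ∀ p : Poly2, (p.map norm1).sum = norm2 p
  | [] => rfl
  | a :: p => by simp [sum_map_norm1 p]

/-- Sum of `norm2` over the blocks is `norm3`. -/
theorem sum_map_norm2 : ∀ p : Poly3, (p.map norm2).sum = norm3 p
  | [] => rfl
  | a :: p => by simp [sum_map_norm2 p]

/-- Size of a packed block: rows of length `≤ D₁`, base `β ≥ 1`, second base `β^{D₁}`, at most `D₂` rows. -/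
theorem natAbs_evZ2_le (β : ℤ) (hβ : 1 ≤ β) (D₁ D₂ : ℕ) (hD₁ : 1 ≤ D₁) (hD₂ : 1 ≤ D₂) (b : Poly2)
    (hlen : b.length ≤ D₂) (hrows : ∀ r ∈ b, r.length ≤ D₁) :
    (evZ2 b β (β ^ D₁)).natAbs ≤ norm2 b * β.natAbs ^ (D₁ - 1) * (β.natAbs ^ D₁) ^ (D₂ - 1) := by
  rw [evZ2_eq_evZ1_map]
  have hX : (1 : ℤ) ≤ β ^ D₁ := one_le_pow₀ hβ
  have h1 := natAbs_evZ1_le (β ^ D₁) hX (b.map fun r => evZ1 r β) (D₂ - 1) (by simp; omega)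
  have h2 : norm1 (b.map fun r => evZ1 r β) ≤ (b.map fun r => norm1 r * β.natAbs ^ (D₁ - 1)).sum :=
    norm1_map_le b _ _ fun r hr => natAbs_evZ1_le β hβ r (D₁ - 1) (by have := hrows r hr; omega)
  have h3 : (b.map fun r => norm1 r * β.natAbs ^ (D₁ - 1)).sum = norm2 b * β.natAbs ^ (D₁ - 1) := by
    rw [← sum_map_norm1, List.sum_map_mul_right]
  rw [Int.natAbs_pow] at h1
  calc _ ≤ norm1 (b.map fun r => evZ1 r β) * (β.natAbs ^ D₁) ^ (D₂ - 1) := h1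
    _ ≤ norm2 b * β.natAbs ^ (D₁ - 1) * (β.natAbs ^ D₁) ^ (D₂ - 1) := by
        rw [← h3]; exact Nat.mul_le_mul_right _ h2

/-- **Injectivity of the packing**: a `Poly3` with rows of length `≤ D₁`, blocks of `≤ D₂` rows and 1-norm `< β` whose
packed value `evZ3 p β β^{D₁} β^{D₁D₂}` vanishes has all coefficients `0`, hence evaluates to `0` everywhere. -/
theorem ev3_eq_zero_of_evZ3_eq_zero (p : Poly3) (β D₁ D₂ : ℕ) (hD₁ : 1 ≤ D₁) (hD₂ : 1 ≤ D₂) (hn : norm3 p < β)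
    (hsh : ∀ b ∈ p, b.length ≤ D₂ ∧ ∀ r ∈ b, r.length ≤ D₁)
    (h0 : evZ3 p β ((β : ℤ) ^ D₁) ((β : ℤ) ^ (D₁ * D₂)) = 0) (w x k : ℚ) : ev3 p w x k = 0 := by
  have hβpos : 0 < β := by omega
  have hβ1 : (1 : ℤ) ≤ β := by exact_mod_cast (show 1 ≤ β by omega)
  have hβabs : ((β : ℤ)).natAbs = β := Int.natAbs_natCast β
  -- level 3: the block values are digits in base `β^{D₁ D₂}`
  have hK : (1 : ℤ) ≤ (β : ℤ) ^ (D₁ * D₂) := one_le_pow₀ hβ1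
  rw [evZ3_eq_evZ1_map] at h0
  have hblk : ∀ e ∈ p.map (fun b => evZ2 b β ((β : ℤ) ^ D₁)), e = 0 := by
    refine digits_eq_zero _ hK _ (fun e he => ?_) h0
    obtain ⟨b, hb, rfl⟩ := List.mem_map.1 he
    have hb2 := natAbs_evZ2_le β hβ1 D₁ D₂ hD₁ hD₂ b (hsh b hb).1 (hsh b hb).2
    have hnb : norm2 b < β := lt_of_le_of_lt (norm2_le_norm3 p b hb) hn
    rw [hβabs] at hb2
    rw [Int.natAbs_pow, hβabs]
    calc _ ≤ norm2 b * β ^ (D₁ - 1) * (β ^ D₁) ^ (D₂ - 1) := hb2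
      _ < β * β ^ (D₁ - 1) * (β ^ D₁) ^ (D₂ - 1) := by
          have hpos : 0 < β ^ (D₁ - 1) * (β ^ D₁) ^ (D₂ - 1) := by positivity
          nlinarith
      _ = β ^ (D₁ * D₂) := by
          have e1 : β * β ^ (D₁ - 1) = β ^ D₁ := by rw [← pow_succ']; congr 1; omega
          have e2 : β ^ D₁ * (β ^ D₁) ^ (D₂ - 1) = (β ^ D₁) ^ D₂ := by rw [← pow_succ']; congr 1; omega
          rw [e1, e2, ← pow_mul]
  -- level 2: inside each block the row values are digits in base `β^{D₁}`
  have hX : (1 : ℤ) ≤ (β : ℤ) ^ D₁ := one_le_pow₀ hβ1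
  have hrow : ∀ b ∈ p, ∀ r ∈ b, evZ1 r β = 0 := by
    intro b hb
    have hb0 : evZ2 b β ((β : ℤ) ^ D₁) = 0 := hblk _ (List.mem_map.2 ⟨b, hb, rfl⟩)
    rw [evZ2_eq_evZ1_map] at hb0
    intro r hr
    refine digits_eq_zero _ hX _ (fun e he => ?_) hb0 _ (List.mem_map.2 ⟨r, hr, rfl⟩)
    obtain ⟨r', hr', rfl⟩ := List.mem_map.1 he
    have h1 := natAbs_evZ1_le β hβ1 r' (D₁ - 1) (by have := (hsh b hb).2 r' hr'; omega)
    have hnr : norm1 r' < β := lt_of_le_of_lt ((norm1_le_norm2 b r' hr').trans (norm2_le_norm3 p b hb)) hn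
    rw [hβabs] at h1
    rw [Int.natAbs_pow, hβabs]
    calc _ ≤ norm1 r' * β ^ (D₁ - 1) := h1
      _ < β * β ^ (D₁ - 1) := by
          have hpos : 0 < β ^ (D₁ - 1) := by positivity
          nlinarith
      _ = β ^ D₁ := by rw [← pow_succ']; congr 1; omega
  -- level 1: the coefficients are digits in base `β`
  have hcoef : ∀ b ∈ p, ∀ r ∈ b, ∀ c ∈ r, c = 0 := by
    intro b hb r hr
    refine digits_eq_zero β hβ1 r (fun c hc => ?_) (hrow b hb r hr)
    rw [hβabs]
    exact lt_of_le_of_lt (((natAbs_le_norm1 r c hc).trans (norm1_le_norm2 b r hr)).trans (norm2_le_norm3 p b hb)) hn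
  -- evaluation of an all-zero polynomial
  have e1 : ∀ r : List ℤ, (∀ c ∈ r, c = 0) → ∀ w : ℚ, ev1 r w = 0 := by
    intro r; induction r with
    | nil => simp
    | cons c r ih => intro h w; simp [h c (by simp), ih (fun d hd => h d (by simp [hd])) w]
  have e2 : ∀ b : Poly2, (∀ r ∈ b, ∀ c ∈ r, c = 0) → ∀ w x : ℚ, ev2 b w x = 0 := by
    intro b; induction b with
    | nil => simp
    | cons r b ih => intro h w x; simp [e1 r (h r (by simp)) w, ih (fun r' hr' => h r' (by simp [hr'])) w x]
  have e3 : ∀ q : Poly3, (∀ b ∈ q, ∀ r ∈ b, ∀ c ∈ r, c = 0) → ev3 q w x k = 0 := by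
    intro q; induction q with
    | nil => simp
    | cons b q ih => intro h; simp [e2 b (h b (by simp)) w x, ih (fun b' hb' => h b' (by simp [hb']))]
  exact e3 p hcoef

/-! ### The packed elimination -/

/-- Packed image of a linear combination: the list of packed values of its entries. -/
def packLC (w x k : ℤ) (E : LC) : List ℤ := E.map fun c => evZ3 c w x k

/-- Pointwise sum of integer lists (shape of `lcAdd`). -/
def zAdd : List ℤ → List ℤ → List ℤ
  | [], F => F
  | E, [] => E
  | a :: E, b :: F => (a + b) :: zAdd E F

/-- Scalar multiple of an integer list. -/
def zSmul (a : ℤ) : List ℤ → List ℤ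
  | [] => []
  | c :: E => (a * c) :: zSmul a E

/-- Entry of an integer list (`0` past the end). -/
def zGet : List ℤ → ℕ → ℤ
  | [], _ => 0
  | c :: _, 0 => c
  | _ :: E, i + 1 => zGet E i

/-- Packed elimination step (multiplier already packed). -/
def elimStepZ (a : ℤ) (R : List ℤ) (s : ℕ) (E : List ℤ) : List ℤ :=
  zAdd (zSmul a E) (zSmul (-(zGet E s)) R)

/-- Packed elimination run: the multipliers of the steps are packed on the fly. -/
def elimRunZ (w x k : ℤ) (rels : List (List ℤ)) : List (ℕ × ℕ × Poly3) → List ℤ → List ℤ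
  | [], E => E
  | (r, s, a) :: st, E => elimRunZ w x k rels st (elimStepZ (evZ3 a w x k) (rels.getD r []) s E)

/-- All entries vanish. -/
def zIsZero : List ℤ → Bool
  | [] => true
  | c :: E => (c == 0) && zIsZero E

/-- `packLC` of a sum. -/
theorem packLC_lcAdd (w x k : ℤ) : ∀ E F : LC, packLC w x k (lcAdd E F) = zAdd (packLC w x k E) (packLC w x k F)
  | [], F => by simp [packLC, lcAdd, zAdd]
  | a :: E, [] => by simp [packLC, lcAdd, zAdd]
  | a :: E, b :: F => by
    have := packLC_lcAdd w x k E F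
    simp only [packLC, List.map_cons] at this ⊢
    simp [lcAdd, zAdd, evZ3_add3, this]

/-- `packLC` of a polynomial multiple. -/
theorem packLC_lcSmul (w x k : ℤ) (a : Poly3) : ∀ E : LC, packLC w x k (lcSmul a E) = zSmul (evZ3 a w x k) (packLC w x k E)
  | [] => by simp [packLC, lcSmul, zSmul]
  | c :: E => by
    have := packLC_lcSmul w x k a E
    simp only [packLC, List.map_cons] at this ⊢
    simp [lcSmul, zSmul, evZ3_mul3, this]

/-- `packLC` and `lcGet`. -/
theorem zGet_packLC (w x k : ℤ) : ∀ (E : LC) (s : ℕ), zGet (packLC w x k E) s = evZ3 (lcGet E s) w x k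
  | [], s => by simp [packLC, zGet, lcGet, evZ3]
  | c :: E, 0 => by simp [packLC, zGet, lcGet]
  | c :: E, s + 1 => by
    have := zGet_packLC w x k E s
    simp only [packLC] at this ⊢
    simpa [zGet, lcGet] using this

/-- `packLC` of an elimination step. -/
theorem packLC_elimStep (w x k : ℤ) (a : Poly3) (R : LC) (s : ℕ) (E : LC) :
    packLC w x k (elimStep a R s E) = elimStepZ (evZ3 a w x k) (packLC w x k R) s (packLC w x k E) := by
  rw [elimStep, elimStepZ, packLC_lcAdd, packLC_lcSmul, packLC_lcSmul, zGet_packLC, evZ3_neg3]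

/-- `packLC` of an elimination run (evaluation is a ring homomorphism). -/
theorem packLC_elimRun (w x k : ℤ) (rels : List LC) :
    ∀ (st : List (ℕ × ℕ × Poly3)) (E : LC),
      packLC w x k (elimRun rels st E) = elimRunZ w x k (rels.map (packLC w x k)) st (packLC w x k E)
  | [], E => by simp [elimRun, elimRunZ]
  | (r, s, a) :: st, E => by
    rw [elimRun, elimRunZ, packLC_elimRun w x k rels st, packLC_elimStep]
    congr 2
    rw [List.getD_eq_getElem?_getD, List.getD_eq_getElem?_getD, List.getElem?_map]
    cases rels[r]? <;> simp [packLC]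

/-- A zero integer list has zero entries. -/
theorem eq_zero_of_zIsZero : ∀ L : List ℤ, zIsZero L = true → ∀ z ∈ L, z = 0
  | [], _ => by simp
  | c :: L, h => by
    simp only [zIsZero, Bool.and_eq_true, beq_iff_eq] at h
    intro z hz
    rcases List.mem_cons.1 hz with rfl | hz
    · exact h.1
    · exact eq_zero_of_zIsZero L h.2 z hz

/-- A combination all of whose entries evaluate to `0` evaluates to `0`. -/
theorem lcEval_eq_zero_of_forall (T : ℕ → ℚ) (w x k : ℚ) :
    ∀ (E : LC) (i : ℕ), (∀ c ∈ E, ev3 c w x k = 0) → lcEval T w x k i E = 0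
  | [], i, _ => rfl
  | c :: E, i, h => by
    simp [h c (by simp), lcEval_eq_zero_of_forall T w x k E (i + 1) fun d hd => h d (by simp [hd])]

/-- The Boolean side conditions of the packed check: the shadow bounds of the run fit the packing parameters. -/
def packFits (rels : List LC) (st : List (ℕ × ℕ × Poly3)) (E : LC) (β D₁ D₂ : ℕ) : Bool :=
  let S := elimShadow rels st (lcMeasure E)
  decide (1 ≤ D₁ ∧ 1 ≤ D₂ ∧ S.1 ≤ D₁ ∧ S.2.1 ≤ D₂ ∧ S.2.2 < β)

/-- **Module reduction by the kernel, packed**: if every relation evaluates to `0`, no pivot vanishes, the shadow bounds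
fit the packing parameters `(β, D₁, D₂)` (`packFits`, by `decide`), and the kernel finds the PACKED elimination result to be
zero (`zIsZero (elimRunZ …) = true`, by `decide` — big-integer arithmetic), then the combination `E` evaluates to `0`. -/
theorem lcEval_eq_zero_of_packedRun (T : ℕ → ℚ) (w x k : ℚ) (rels : List LC) (st : List (ℕ × ℕ × Poly3)) (E : LC)
    (β D₁ D₂ : ℕ) (h : ∀ R ∈ rels, lcEval T w x k 0 R = 0) (hp : ∀ p ∈ pivots st, ev3 p w x k ≠ 0)
    (hfit : packFits rels st E β D₁ D₂ = true)
    (hz : zIsZero (elimRunZ β ((β : ℤ) ^ D₁) ((β : ℤ) ^ (D₁ * D₂)) (rels.map (packLC β ((β : ℤ) ^ D₁) ((β : ℤ) ^ (D₁ * D₂))))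
      st (packLC β ((β : ℤ) ^ D₁) ((β : ℤ) ^ (D₁ * D₂)) E)) = true) :
    lcEval T w x k 0 E = 0 := by
  simp only [packFits, decide_eq_true_eq] at hfit
  obtain ⟨hD₁, hD₂, hW, hX, hH⟩ := hfit
  have hm := one_le_lcMeasure E
  have hfits := lcFits_elimRun rels st E (lcMeasure E).1 (lcMeasure E).2.1 (lcMeasure E).2.2 hm.1 hm.2.1
    (lcFits_measure E)
  rw [← packLC_elimRun] at hz
  have hzero := eq_zero_of_zIsZero _ hz
  have hall : ∀ c ∈ elimRun rels st E, ev3 c w x k = 0 := by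
    intro c hc
    have hc' := hfits c hc
    refine ev3_eq_zero_of_evZ3_eq_zero c β D₁ D₂ hD₁ hD₂ (lt_of_le_of_lt hc'.2 hH)
      (fun b hb => ⟨(hc'.1 b hb).1.trans hX, fun r hr => ((hc'.1 b hb).2 r hr).trans hW⟩) ?_ w x k
    exact hzero _ (List.mem_map.2 ⟨c, hc, rfl⟩)
  have h1 := lcEval_elimRun T w x k rels h st E
  rw [lcEval_eq_zero_of_forall T w x k _ 0 hall] at h1
  have hprod : ((pivots st).map fun p => ev3 p w x k).prod ≠ 0 :=
    List.prod_ne_zero fun h0 => by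
      obtain ⟨p, hpmem, hp0⟩ := List.mem_map.1 h0
      exact hp p hpmem hp0
  exact (mul_eq_zero.1 h1.symm).resolve_left hprod

/-- **Module reduction by the kernel, packed, on trimmed data** — the form used by the certificate files: the same as
`lcEval_eq_zero_of_packedRun`, but the combination, the relations and the multipliers are first TRIMMED of trailing zeros
(`lcTrim`, `stTrim`; values unchanged), so that the shadow degree bounds are the true degrees of the data. -/
theorem lcEval_eq_zero_of_packedRunTrim (T : ℕ → ℚ) (w x k : ℚ) (rels : List LC) (st : List (ℕ × ℕ × Poly3)) (E : LC)
    (β D₁ D₂ : ℕ) (h : ∀ R ∈ rels, lcEval T w x k 0 R = 0) (hp : ∀ p ∈ pivots st, ev3 p w x k ≠ 0)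
    (hfit : packFits (rels.map lcTrim) (stTrim st) (lcTrim E) β D₁ D₂ = true)
    (hz : zIsZero (elimRunZ β ((β : ℤ) ^ D₁) ((β : ℤ) ^ (D₁ * D₂))
      ((rels.map lcTrim).map (packLC β ((β : ℤ) ^ D₁) ((β : ℤ) ^ (D₁ * D₂)))) (stTrim st)
      (packLC β ((β : ℤ) ^ D₁) ((β : ℤ) ^ (D₁ * D₂)) (lcTrim E))) = true) :
    lcEval T w x k 0 E = 0 := by
  rw [← lcEval_lcTrim]
  refine lcEval_eq_zero_of_packedRun T w x k (rels.map lcTrim) (stTrim st) (lcTrim E) β D₁ D₂ ?_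
    (pivots_stTrim_ne_zero hp) hfit hz
  intro R hR
  obtain ⟨R', hR', rfl⟩ := List.mem_map.1 hR
  rw [lcEval_lcTrim]; exact h R' hR'

end Summit.KontsevichZagierPeriods.Zeta5Search.PolyReflect
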